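import Summits.ResolutionOfSingularities.ResolutionOfSingularities.Theorems.PurelyInseparableDim4ResConeHeavyLoseTail
import Summits.ResolutionOfSingularities.ResolutionOfSingularities.Theorems.PurelyInseparableDim4ResConeKeepBudget
import HarnessLib
import HarnessLib.Audit.Tags

/-!
# Purely inseparable four-folds — NO TAIL WITH A UNIQUE LETTER OF THE NEWBORN'S WEIGHT, every prime `p`, every shade `d`
# (the «pure hit loops» of the weight ledger are free tails; K2(p) lane, rung-1 generic material; cell `res-dim4-pi`)

[OURS · counted 0 · cell `res-dim4-pi` · K2(p) lane holder res-dim4-p-12 g4 (K2(7) SCOPING v1.1 §2a «the case list is SCC-orbits»,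
§3 rung 1 «generic files (no `7` in a signature) are always welcome»; holder 08:51:52Z «tiny loops first (generic E/K/L + dock)»); seat
res-dim4-p-2 g6 (rung-0 data l.5433 / DATUM #2 / DATUM #3: of the 17 recurrent SCC-orbits of the `p = 7` binary-cone weight ledger, five —
the `(3,1)`-loop at `(7,6)`, the `(3,1,1)`-loop at `(7,5)`, the `(3,1,1,1)`/`(4,1,1,1)` self-loops at `(7,4)`, the `(4,1)`-loop at `(7,3)` —
are loops in which every step hits THE UNIQUE LETTER CARRYING THE NEWBORN'S WEIGHT).]  Nothing here proves any TAIL(p, d, e), K2(7), K2(5)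
beyond p708920's model statement, or resolution of singularities in dimension ≥ 4 / characteristic `p` — NOT proved.  AI kernel work,
weaker than expert review.

THE LEMMA (weights + FT only — no frame, no polygon, no `e_G`): along a witnessed isolated above-floor `Step0 p` chain with `x^{r₀} ∣ F₀` and
constant shade `d` from `k₀`, suppose that from `k₁ ≥ k₀` on the newborn weight `|r_k| + d − p` is a constant `w` and every state has AT MOST
ONE letter of weight `w`.  Then the chain cannot exist: the letter `j k` born at step `k` weighs `w` in `c (k+1)` (`tail_newborn_weight`);
if step `k+1` neither re-uses it as chart nor translates it, it survives into `c (k+2)` with weight `w` next to the new newborn `j (k+1) ≠ j k`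
of the same weight — two letters of weight `w`; so every step from `k₁ + 1` on is FREE (`j (k+1) = j k ∨ b (k+1) (j k) ≠ 0`) and
`no_tail_of_eventually_free` (FT, res-dim4-p-7's dock file `…ResConeKeepBudget`) ends it.
* §1 **`free_of_unique_weight`** — the step-level statement: under the two binders, step `k+1` is free for every `k ≥ k₁`;
* §2 **`no_tail_of_unique_newborn_weight`** — the tail statement (`False`);
* §3 **`no_tail_of_unique_heavy_letter`** — the class-shaped corollary a rung-2 consumer meets: from `k₁` on every state has a letter `W`
  of weight `w` with all other letters of weight `≠ w`, and `|r_k| + d − p = w` (e.g. the ledger classes `(w,1,…,1)` with `w ≥ 2` at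
  `|r| + d − p = w`, or `(4,1)` at `(7,3)` with `w = 1`).
At `p = 5` the lemma is vacuous on the four recurrent orbits (none is a pure hit loop) — consistent with the `p = 5` campaign.  It is the
frame-free shadow of the LOSE law: where L_gen/`tail_heavy_lose_step` would run with `βs′ ≤ βs` forever and no KEEP step to force a drop,
FT already forbids the loop.
[cite: CossartJannsenSaito2020, Thm. 3.14, Lemma 13.4] [cite: HauserPerlega2019PRIMS, §2 (transform D' of D)]
bears_on: LADDER-RESOLUTION:D157-DOOR2 (res-dim4-pi · K2(p) · rung 1 · pure hit loops are free tails).  Supports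
stmt-ResolutionOfSingularities-16155 (helper).
-/

set_option linter.dupNamespace false -- mandated namespace of this single-conjunct summit

noncomputable section

namespace Summit.ResolutionOfSingularities.ResolutionOfSingularities.Theorems.PIDim4

namespace ResCone

open MvPolynomial Finset IsLocalRing
open Literature.AlgebraicGeometry.Resolution
open Literature.AlgebraicGeometry.Resolution.CentreBlowup
open Literature.AlgebraicGeometry.Resolution.Hauser2010
open Literature.AlgebraicGeometry.Resolution.HauserPerlega2019
open Literature.AlgebraicGeometry.Resolution.WeightedOrder

variable {K : Type} [Field K] {p : ℕ} [Fact p.Prime] [DecidableEq K]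

/-! ## 1. The step after a newborn of unique weight is free -/

/-- **A newborn of unique weight is hit at the next step.**  Along a witnessed isolated above-floor `Step0 p` chain with `x^{r₀} ∣ F₀` and
constant shade `d` from `k₀`: if from `k₁ ≥ k₀` on the newborn weight `|r_k| + d − p` is a constant `w` and no state has two distinct
letters of weight `w`, then for every `k ≥ k₁` the step `k+1` is FREE with respect to the letter born at step `k`:
`j (k+1) = j k ∨ b (k+1) (j k) ≠ 0`.  (Otherwise `c (k+2)` keeps `j k` at weight `w` beside its own newborn `j (k+1)` of weight `w`.)
[OURS · bookkeeping] [cite: HauserPerlega2019PRIMS, §2 (transform D' of D)] -/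
theorem free_of_unique_weight {c : ℕ → State K} {j : ℕ → Fin 4} {b : ℕ → Fin 4 → K}
    (hc : ∀ k, IsIsolated p (c k).F ∧ Step0 p (c k) (c (k + 1))) (hw : FreeTail.IsWitnessedChain p c j b)
    (hr0 : ∀ e ∈ (c 0).F.support, (c 0).r ≤ e) (hfloor : ∀ k, ordZero (c k).F ≠ p) {k₀ d : ℕ}
    (hshade : ∀ k, k₀ ≤ k → (c k).shade = ((d : ℕ) : ℕ∞)) {k₁ : ℕ} (hk₁ : k₀ ≤ k₁) {w : ℕ}
    (hnew : ∀ k, k₁ ≤ k → (c k).r.degree + d - p = w)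
    (huniq : ∀ k, k₁ ≤ k → ∀ i i', (c k).r i = w → (c k).r i' = w → i = i')
    {k : ℕ} (hk : k₁ ≤ k) : j (k + 1) = j k ∨ b (k + 1) (j k) ≠ 0 := by
  classical
  by_contra hsat
  push Not at hsat
  obtain ⟨hne, hb0⟩ := hsat
  obtain ⟨-, hlaw, -, -, -⟩ := tail_weights_laws hc hw hr0 hfloor hshade
  -- the letter born at step `k` weighs `w` in `c (k+1)` and, being untouched by step `k+1`, still in `c (k+2)`
  obtain ⟨hr₁, -, -, -⟩ := tail_newborn_weight hc hw hr0 hfloor hshade (k := k) (by omega)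
  obtain ⟨hr₂, -, -, -⟩ := tail_newborn_weight hc hw hr0 hfloor hshade (k := k + 1) (by omega)
  rw [hnew k hk] at hr₁
  rw [hnew (k + 1) (by omega)] at hr₂
  have hkept : (c (k + 1 + 1)).r (j k) = w := by
    rw [hlaw (k + 1) (by omega), Finsupp.coe_update, Function.update_of_ne (Ne.symm hne), Finsupp.filter_apply, if_pos hb0, hr₁]
  exact hne (huniq (k + 1 + 1) (by omega) _ _ hr₂ hkept)

/-! ## 2. No tail with a unique letter of the newborn's weight -/

/-- **NO TAIL WITH A UNIQUE LETTER OF THE NEWBORN'S WEIGHT, every prime `p`, every shade `d`.**  Along a witnessed isolated above-floor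
`Step0 p` chain with `x^{r₀} ∣ F₀` and constant shade `d` from `k₀`, it is impossible that from some `k₁ ≥ k₀` on the newborn weight
`|r_k| + d − p` is a constant `w` while no state has two distinct letters of weight `w`: by `free_of_unique_weight` every step from `k₁ + 1`
on is free, and a free tail passes through a non-isolated state (FT, `no_tail_of_eventually_free`).  Ledger reading (OUR frame, `p = 7`):
the `(3,1)`-loop at `(7,6)`, the `(3,1,1)`-loop at `(7,5)`, the `(3,1,1,1)` and `(4,1,1,1)` self-loops at `(7,4)` and the `(4,1)`-loop at
`(7,3)` are such tails. [OURS] [cite: CossartJannsenSaito2020, Thm. 3.14, Lemma 13.4] -/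
theorem no_tail_of_unique_newborn_weight [CharP K p] {c : ℕ → State K} {j : ℕ → Fin 4} {b : ℕ → Fin 4 → K}
    (hc : ∀ k, IsIsolated p (c k).F ∧ Step0 p (c k) (c (k + 1))) (hw : FreeTail.IsWitnessedChain p c j b)
    (hr0 : ∀ e ∈ (c 0).F.support, (c 0).r ≤ e) (hfloor : ∀ k, ordZero (c k).F ≠ p) {k₀ d : ℕ}
    (hshade : ∀ k, k₀ ≤ k → (c k).shade = ((d : ℕ) : ℕ∞)) {k₁ : ℕ} (hk₁ : k₀ ≤ k₁) {w : ℕ}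
    (hnew : ∀ k, k₁ ≤ k → (c k).r.degree + d - p = w)
    (huniq : ∀ k, k₁ ≤ k → ∀ i i', (c k).r i = w → (c k).r i' = w → i = i') : False :=
  no_tail_of_eventually_free p hc hw (k₁ := k₁) fun _ hk =>
    free_of_unique_weight hc hw hr0 hfloor hshade hk₁ hnew huniq hk

/-! ## 3. The class-shaped corollary -/

/-- **NO TAIL IN A «UNIQUE HEAVY LETTER» CLASS WHOSE NEWBORNS HAVE THAT WEIGHT** (the form a rung-2 consumer meets): along a witnessed
isolated above-floor `Step0 p` chain with `x^{r₀} ∣ F₀` and constant shade `d` from `k₀`, there is no `k₁ ≥ k₀` from which on every state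
has a letter `W` of weight `w` with all other letters of weight `≠ w` and the newborn weight `|r_k| + d − p` equals `w` — e.g. the ledger
classes `(w, 1, …, 1)`, `w ≥ 2`, at `|r| + d − p = w` (`(3,1)` at `(7,6)`, `(3,1,1)` at `(7,5)`, `(3,1,1,1)` / `(4,1,1,1)` at `(7,4)`) and
`(4,1)` at `(7,3)` (`w = 1`).  Immediate from `no_tail_of_unique_newborn_weight`. [OURS] [cite: CossartJannsenSaito2020, Thm. 3.14] -/
theorem no_tail_of_unique_heavy_letter [CharP K p] {c : ℕ → State K} {j : ℕ → Fin 4} {b : ℕ → Fin 4 → K}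
    (hc : ∀ k, IsIsolated p (c k).F ∧ Step0 p (c k) (c (k + 1))) (hw : FreeTail.IsWitnessedChain p c j b)
    (hr0 : ∀ e ∈ (c 0).F.support, (c 0).r ≤ e) (hfloor : ∀ k, ordZero (c k).F ≠ p) {k₀ d : ℕ}
    (hshade : ∀ k, k₀ ≤ k → (c k).shade = ((d : ℕ) : ℕ∞)) {k₁ : ℕ} (hk₁ : k₀ ≤ k₁) {w : ℕ}
    (hclass : ∀ k, k₁ ≤ k → (∃ W, (c k).r W = w ∧ ∀ i, i ≠ W → (c k).r i ≠ w) ∧ (c k).r.degree + d - p = w) : False := by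
  refine no_tail_of_unique_newborn_weight hc hw hr0 hfloor hshade hk₁ (w := w) (fun k hk => (hclass k hk).2) fun k hk i i' hi hi' => ?_
  obtain ⟨⟨W, -, hW⟩, -⟩ := hclass k hk
  have hiW : i = W := by
    by_contra h
    exact hW i h hi
  have hi'W : i' = W := by
    by_contra h
    exact hW i' h hi'
  rw [hiW, hi'W]

end ResCone

end Summit.ResolutionOfSingularities.ResolutionOfSingularities.Theorems.PIDim4

end
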